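import Mathlib.Analysis.Matrix.Order
import Literature.MathematicalPhysics.QuantumLattice.MatrixProductStatesProofs
import Literature.MathematicalPhysics.QuantumLattice.TraceInequalitiesProofs
import HarnessLib

/-!
# Perron–Frobenius for the transfer operator of an injective MPS tensor

Sibling file of `Literature/MathematicalPhysics/QuantumLattice/MatrixProductStates.lean` (transfer
operator `𝔼(X) = Σ_i A^i X (A^i)†` of an MPS tensor, `transferOp`; injectivity `IsInjectiveMPS`)
on the way to the discharge of
`Literature.MathematicalPhysics.QuantumLattice.fannes_nachtergaele_werner_decay`
(`LiebRobinson.lean`: exponential clustering of the periodic MPS of a normal tensor). Theorems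
only, no definition and no named fact is introduced.

Content (all for an MPS tensor `A : Fin q → M_D(ℂ)`):

* `transferOp_pow_apply` — the iterate `𝔼^ℓ(X) = Σ_w A^w X (A^w)†` is the completely positive map
  with Kraus operators the word products `A^w = A^{w₀} ⋯ A^{w_{ℓ-1}}` (`wordProduct`);
  `transferOp_pow_posSemidef`.
* `IsInjectiveMPS.posDef_transferOp_pow` — **strict positivity**: if the words of length `ℓ`
  span `M_D(ℂ)` (injectivity, Perez-Garcia–Verstraete–Wolf–Cirac 2007 §3.2) then `𝔼^ℓ` maps
  every non-zero positive semidefinite matrix to a positive *definite* one.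
* `IsInjectiveMPS.exists_posDef_eigenvector` — **Perron–Frobenius eigenvector**: for an
  injective tensor of positive bond dimension there are `r₀ > 0` and a positive definite `X₀`
  with `𝔼(X₀) = r₀ X₀`.

## Sources

* D. E. Evans, R. Høegh-Krohn, *Spectral properties of positive maps on C⋆-algebras*,
  J. London Math. Soc. (2) **17** (1978) 345–355, Thm. 2.3–2.4 (Perron–Frobenius theory of
  positive maps on finite-dimensional C⋆-algebras: the spectral radius is an eigenvalue with a
  positive eigenvector; irreducibility/strict positivity give a positive definite one).
* M. Fannes, B. Nachtergaele, R. F. Werner, *Finitely correlated states on quantum spin chains*,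
  Comm. Math. Phys. **144** (1992) 443–490, §3 (eq. (3.1), Prop. 3.1) and §5 ((5.1), Lemma 5.2):
  the role of the fixed point of `𝔼` and of the trivial peripheral spectrum.
  [FannesNachtergaeleWernerCMP1992]
* D. Perez-Garcia, F. Verstraete, M. M. Wolf, J. I. Cirac, *Matrix product state
  representations*, Quantum Inf. Comput. **7** (2007) 401–430, §3.2 (injectivity ⇔ the Kraus
  operators of `𝔼^ℓ` span `M_D(ℂ)`; Lemma 4, Thm. 5). [PerezGarciaVerstraeteWolfCiracQIC2007]

## Proof sketch (Collatz–Wielandt, no spectral theory)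

Let `S` be the (compact) set of matrices `Gᴴ G` with `‖G‖ = 1`; every non-zero positive
semidefinite matrix is a positive multiple of an element of `S`. Let
`R = {t : ℝ | ∃ Z ∈ S, t Z ≤ 𝔼 Z}` (Loewner order). `R` contains `0` and is bounded above (compare
traces: `tr (𝔼 Z) ≤ M` and `tr Z ≥ m > 0` on the compact set `S`). Let `r₀ = sup R`; by
compactness of `S` and closedness of the positive cone there is `Z⋆ ∈ S` with `r₀ Z⋆ ≤ 𝔼 Z⋆`. If
the inequality were strict somewhere, i.e. `W = 𝔼 Z⋆ - r₀ Z⋆ ≥ 0` non-zero, strict positivity of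
`𝔼^ℓ` would give `𝔼 Z₁ - r₀ Z₁ = 𝔼^ℓ W > 0` for `Z₁ = 𝔼^ℓ Z⋆`, hence `(r₀ + ε) Z₁ ≤ 𝔼 Z₁` for some
`ε > 0`, contradicting the definition of `r₀`. So `𝔼 Z⋆ = r₀ Z⋆`; then `r₀^ℓ Z⋆ = 𝔼^ℓ Z⋆ > 0` forces
`r₀ > 0` and `Z⋆ > 0`. This is the classical Collatz–Wielandt argument (Evans–Høegh-Krohn 1978
§2 for positive maps), run with the strictly positive iterate `𝔼^ℓ`.

## Mathlib

Uses the Loewner partial order on matrices (`Mathlib.Analysis.Matrix.Order`, scoped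
`MatrixOrder`), the L²-operator norm (scoped `Matrix.Norms.L2Operator`), `Matrix.PosSemidef` /
`Matrix.PosDef` API (`posSemidef_iff_dotProduct_mulVec`, `PosSemidef.dotProduct_mulVec_zero_iff`,
`PosSemidef.trace_eq_zero_iff`, `CStarAlgebra.nonneg_iff_eq_star_mul_self`), compactness of
spheres in finite dimension and `IsCompact.tendsto_subseq`, `exists_seq_tendsto_sSup`; from the tree,
`isHermitian_real_smul` (`TraceInequalitiesProofs`). Mathlib has no Perron–Frobenius theory
(neither for non-negative matrices nor for positive maps).
-/

noncomputable section

open Matrix Filter Topology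
open scoped ComplexOrder MatrixOrder Matrix.Norms.L2Operator

namespace Literature.MathematicalPhysics.QuantumLattice

section QLattice

variable {q D : ℕ}

/-! ### Quadratic forms: small helpers -/

section Helpers

variable {n : Type*} [Fintype n]

/-- A Hermitian matrix whose quadratic form has non-negative real part is positive semidefinite
(the imaginary part vanishes automatically). [folklore] -/
theorem posSemidef_of_re_nonneg {M : Matrix n n ℂ} (hM : M.IsHermitian)
    (h : ∀ x : n → ℂ, 0 ≤ (star x ⬝ᵥ M *ᵥ x).re) : M.PosSemidef :=
  PosSemidef.of_dotProduct_mulVec_nonneg hM fun x =>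
    Complex.nonneg_iff.2 ⟨h x, (hM.im_star_dotProduct_mulVec_self x).symm⟩

/-- A Hermitian matrix whose quadratic form has positive real part on non-zero vectors is
positive definite. [folklore] -/
theorem posDef_of_re_pos {M : Matrix n n ℂ} (hM : M.IsHermitian)
    (h : ∀ x : n → ℂ, x ≠ 0 → 0 < (star x ⬝ᵥ M *ᵥ x).re) : M.PosDef :=
  PosDef.of_dotProduct_mulVec_pos hM fun x hx =>
    Complex.pos_iff.2 ⟨h x hx, (hM.im_star_dotProduct_mulVec_self x).symm⟩

/-- The quadratic form of a sum of matrices. [folklore] -/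
theorem star_dotProduct_sum_mulVec {ι : Type*} (s : Finset ι) (M : ι → Matrix n n ℂ)
    (x : n → ℂ) : star x ⬝ᵥ (∑ i ∈ s, M i) *ᵥ x = ∑ i ∈ s, star x ⬝ᵥ M i *ᵥ x := by
  rw [Matrix.sum_mulVec, dotProduct_sum]

/-- The quadratic form of `B X Bᴴ` at `x` is the quadratic form of `X` at `Bᴴ x`. [folklore] -/
theorem star_dotProduct_conj_mulVec (B X : Matrix n n ℂ) (x : n → ℂ) :
    star x ⬝ᵥ (B * X * Bᴴ) *ᵥ x = star (Bᴴ *ᵥ x) ⬝ᵥ X *ᵥ (Bᴴ *ᵥ x) := by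
  rw [← mulVec_mulVec, ← mulVec_mulVec, dotProduct_mulVec, star_mulVec, conjTranspose_conjTranspose]

/-- A matrix annihilating every vector is zero. [folklore] -/
theorem eq_zero_of_forall_mulVec_eq_zero [DecidableEq n] {M : Matrix n n ℂ}
    (h : ∀ u : n → ℂ, M *ᵥ u = 0) :
    M = 0 := by
  have h' : Matrix.toLin' M = 0 := LinearMap.ext fun u => by simpa using h u
  simpa using h'

end Helpers

/-! ### Iterates of the transfer operator -/

/-- **Iterated transfer operator.** `𝔼^ℓ(X) = Σ_{w : Fin ℓ → Fin q} A^w X (A^w)†` with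
`A^w = A^{w₀} ⋯ A^{w_{ℓ-1}}` the word product: the `ℓ`-fold composition of the completely positive
map `𝔼` has Kraus operators the words of length `ℓ`. Perez-Garcia–Verstraete–Wolf–Cirac (2007)
§3.2 (the map `Γ_ℓ` and `𝔼^ℓ`); Fannes–Nachtergaele–Werner (1992) §5 eq. (5.5).
[cite: PerezGarciaVerstraeteWolfCiracQIC2007, §3.2] -/
theorem transferOp_pow_apply (A : MPSTensor q D) (ℓ : ℕ) (X : Matrix (Fin D) (Fin D) ℂ) :
    (transferOp A ^ ℓ) X = ∑ w : Fin ℓ → Fin q, wordProduct A w * X * (wordProduct A w)ᴴ := by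
  induction ℓ generalizing X with
  | zero => simp [wordProduct]
  | succ ℓ ih =>
    rw [pow_succ', Module.End.mul_apply, ih, transferOp_apply]
    symm
    rw [← (Fin.consEquiv fun _ : Fin (ℓ + 1) => Fin q).sum_comp, Fintype.sum_prod_type]
    refine Finset.sum_congr rfl fun i _ => ?_
    rw [Finset.mul_sum, Finset.sum_mul]
    refine Finset.sum_congr rfl fun w _ => ?_
    have hc : (Fin.consEquiv fun _ : Fin (ℓ + 1) => Fin q) (i, w) = Fin.cons i w := rfl
    rw [hc, wordProduct_cons]
    simp only [conjTranspose_mul, Matrix.mul_assoc]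

/-- The iterates of the transfer operator are positive maps. Fannes–Nachtergaele–Werner (1992)
§2. [cite: FannesNachtergaeleWernerCMP1992, §2] -/
theorem transferOp_pow_posSemidef (A : MPSTensor q D) (ℓ : ℕ) {X : Matrix (Fin D) (Fin D) ℂ}
    (hX : X.PosSemidef) : ((transferOp A ^ ℓ) X).PosSemidef := by
  rw [transferOp_pow_apply]
  exact posSemidef_sum _ fun w _ => hX.mul_mul_conjTranspose_same _

/-- The transfer operator commutes with its iterates (as elements of `End(M_D)`). [folklore] -/
theorem transferOp_pow_comm_apply (A : MPSTensor q D) (ℓ : ℕ) (X : Matrix (Fin D) (Fin D) ℂ) :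
    (transferOp A ^ ℓ) (transferOp A X) = transferOp A ((transferOp A ^ ℓ) X) := by
  rw [← Module.End.mul_apply, ← pow_succ, pow_succ', Module.End.mul_apply]

/-! ### Strict positivity from injectivity -/

/-- If the words of length `ℓ` span `M_D(ℂ)` then for `X ≠ 0` and `v ≠ 0` some word `W` has
`X (Wᴴ v) ≠ 0`: otherwise `X Yᴴ v = 0` for every `Y` in the span, i.e. for all `Y`, and taking
`Y = v u†` gives `X u = 0` for all `u`. Perez-Garcia–Verstraete–Wolf–Cirac (2007) §3.2.
[cite: PerezGarciaVerstraeteWolfCiracQIC2007, §3.2] -/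
theorem IsInjectiveMPS.exists_mulVec_ne_zero {A : MPSTensor q D} {ℓ : ℕ} (h : IsInjectiveMPS A ℓ)
    {X : Matrix (Fin D) (Fin D) ℂ} (hX : X ≠ 0) {v : Fin D → ℂ} (hv : v ≠ 0) :
    ∃ w : Fin ℓ → Fin q, X *ᵥ ((wordProduct A w)ᴴ *ᵥ v) ≠ 0 := by
  by_contra hall
  push Not at hall
  have key : ∀ Y : Matrix (Fin D) (Fin D) ℂ, X *ᵥ (Yᴴ *ᵥ v) = 0 := by
    intro Y
    have hY : Y ∈ Submodule.span ℂ (Set.range (wordProduct (ℓ := ℓ) A)) := by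
      rw [h]; exact Submodule.mem_top
    induction hY using Submodule.span_induction with
    | mem x hx =>
      obtain ⟨w, rfl⟩ := hx
      exact hall w
    | zero => simp
    | add x y _ _ hx hy => simp [conjTranspose_add, add_mulVec, mulVec_add, hx, hy]
    | smul c x _ hx => simp [conjTranspose_smul, smul_mulVec, mulVec_smul, hx]
  have hvv : star v ⬝ᵥ v ≠ 0 := fun h0 => hv (dotProduct_star_self_eq_zero.mp h0)
  refine hX (eq_zero_of_forall_mulVec_eq_zero fun u => ?_)
  have hu := key (vecMulVec v (star u))
  rw [conjTranspose_vecMulVec, star_star, vecMulVec_mulVec, mulVec_smul] at hu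
  simpa [hvv] using hu

/-- **Strict positivity of `𝔼^ℓ` for an injective tensor.** If the words of length `ℓ` span
`M_D(ℂ)` then `𝔼^ℓ(X) = Σ_w A^w X (A^w)†` is positive definite for every non-zero positive
semidefinite `X`: `⟨v, 𝔼^ℓ(X) v⟩ = Σ_w ⟨(A^w)† v, X (A^w)† v⟩` and some term is non-zero by
`IsInjectiveMPS.exists_mulVec_ne_zero`. This is the implication "injective ⇒ `𝔼^ℓ` strictly
positive (primitive)" of Perez-Garcia–Verstraete–Wolf–Cirac (2007) §3.2 (Lemma 4 / Thm. 5);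
cf. Evans–Høegh-Krohn (1978) §2. [cite: PerezGarciaVerstraeteWolfCiracQIC2007, §3.2 Lemma 4] -/
theorem IsInjectiveMPS.posDef_transferOp_pow {A : MPSTensor q D} {ℓ : ℕ} (h : IsInjectiveMPS A ℓ)
    {X : Matrix (Fin D) (Fin D) ℂ} (hX : X.PosSemidef) (hX0 : X ≠ 0) :
    ((transferOp A ^ ℓ) X).PosDef := by
  refine PosDef.of_dotProduct_mulVec_pos (transferOp_pow_posSemidef A ℓ hX).isHermitian ?_
  intro v hv
  rw [transferOp_pow_apply, star_dotProduct_sum_mulVec]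
  obtain ⟨w, hw⟩ := h.exists_mulVec_ne_zero hX0 hv
  refine Finset.sum_pos' (fun w' _ => ?_) ⟨w, Finset.mem_univ _, ?_⟩
  · rw [star_dotProduct_conj_mulVec]
    exact hX.dotProduct_mulVec_nonneg _
  · rw [star_dotProduct_conj_mulVec]
    refine lt_of_le_of_ne (hX.dotProduct_mulVec_nonneg _) (Ne.symm ?_)
    rwa [Ne, hX.dotProduct_mulVec_zero_iff]

/-! ### Normalised positive matrices -/

/-- The set `S = {Gᴴ G : ‖G‖ = 1}` of normalised positive semidefinite matrices used in the
Collatz–Wielandt argument is compact. [folklore] -/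
theorem isCompact_normPSD (D : ℕ) :
    IsCompact ((fun G : Matrix (Fin D) (Fin D) ℂ => Gᴴ * G) '' Metric.sphere 0 1) :=
  (isCompact_sphere 0 1).image (continuous_id.matrix_conjTranspose.matrix_mul continuous_id)

/-- Elements of `S = {Gᴴ G : ‖G‖ = 1}` are positive semidefinite. [folklore] -/
theorem posSemidef_of_mem_normPSD {Z : Matrix (Fin D) (Fin D) ℂ}
    (hZ : Z ∈ (fun G : Matrix (Fin D) (Fin D) ℂ => Gᴴ * G) '' Metric.sphere 0 1) :
    Z.PosSemidef := by
  obtain ⟨G, -, rfl⟩ := hZ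
  exact posSemidef_conjTranspose_mul_self G

/-- Elements of `S = {Gᴴ G : ‖G‖ = 1}` are non-zero. [folklore] -/
theorem ne_zero_of_mem_normPSD {Z : Matrix (Fin D) (Fin D) ℂ}
    (hZ : Z ∈ (fun G : Matrix (Fin D) (Fin D) ℂ => Gᴴ * G) '' Metric.sphere 0 1) : Z ≠ 0 := by
  obtain ⟨G, hG, rfl⟩ := hZ
  rw [Ne, conjTranspose_mul_self_eq_zero]
  rintro rfl
  simp at hG

/-- Every non-zero positive semidefinite matrix is a positive multiple of an element of
`S = {Gᴴ G : ‖G‖ = 1}` (write `Z = Bᴴ B` and normalise `B`). [folklore] -/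
theorem exists_smul_mem_normPSD {Z : Matrix (Fin D) (Fin D) ℂ} (hZ : Z.PosSemidef)
    (hZ0 : Z ≠ 0) : ∃ c : ℝ, 0 < c ∧
      ∃ Z' ∈ (fun G : Matrix (Fin D) (Fin D) ℂ => Gᴴ * G) '' Metric.sphere 0 1,
        Z = (c : ℂ) • Z' := by
  obtain ⟨B, hB⟩ := CStarAlgebra.nonneg_iff_eq_star_mul_self.mp hZ.nonneg
  have hB0 : B ≠ 0 := by
    rintro rfl
    exact hZ0 (by simpa using hB)
  have hnB : 0 < ‖B‖ := norm_pos_iff.mpr hB0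
  refine ⟨‖B‖ ^ 2, by positivity, ((‖B‖⁻¹ : ℂ) • B)ᴴ * ((‖B‖⁻¹ : ℂ) • B), ⟨(‖B‖⁻¹ : ℂ) • B, ?_, rfl⟩,
    ?_⟩
  · simp [norm_smul, hnB.ne']
  · rw [conjTranspose_smul, smul_mul_smul_comm, ← star_eq_conjTranspose, ← hB, smul_smul]
    have : (((‖B‖ ^ 2 : ℝ) : ℂ)) * (star ((‖B‖ : ℂ)⁻¹) * (‖B‖ : ℂ)⁻¹) = 1 := by
      rw [Complex.star_def, map_inv₀, Complex.conj_ofReal]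
      push_cast
      field_simp
    rw [this, one_smul]

/-! ### Closedness of the positive cone, scaling of quadratic forms -/

section Cone

variable {n : Type*} [Fintype n]

/-- The cone of positive semidefinite matrices is closed. [folklore] -/
theorem isClosed_setOf_posSemidef : IsClosed {M : Matrix n n ℂ | M.PosSemidef} := by
  have hset : {M : Matrix n n ℂ | M.PosSemidef} =
      {M | Mᴴ = M} ∩ ⋂ x : n → ℂ, {M | 0 ≤ (star x ⬝ᵥ M *ᵥ x).re} := by
    ext M
    simp only [Set.mem_setOf_eq, Set.mem_inter_iff, Set.mem_iInter]
    exact ⟨fun hM => ⟨hM.isHermitian, fun x => hM.re_dotProduct_nonneg x⟩,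
      fun hM => posSemidef_of_re_nonneg hM.1 hM.2⟩
  rw [hset]
  refine (isClosed_eq continuous_id.matrix_conjTranspose continuous_id).inter
    (isClosed_iInter fun x => isClosed_le continuous_const ?_)
  exact Complex.continuous_re.comp
    (continuous_const.dotProduct (continuous_id.matrix_mulVec continuous_const))

/-- A limit of positive semidefinite matrices is positive semidefinite. [folklore] -/
theorem posSemidef_of_tendsto {f : ℕ → Matrix n n ℂ} {M : Matrix n n ℂ}
    (hf : Tendsto f atTop (𝓝 M)) (h : ∀ k, (f k).PosSemidef) : M.PosSemidef :=
  isClosed_setOf_posSemidef.mem_of_tendsto hf (Eventually.of_forall h)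

/-- Scaling of a quadratic form: `⟨c x, M (c x)⟩ = conj c · c · ⟨x, M x⟩`. [folklore] -/
theorem star_smul_dotProduct_mulVec_smul (M : Matrix n n ℂ) (c : ℂ) (x : n → ℂ) :
    star (c • x) ⬝ᵥ M *ᵥ (c • x) = (starRingEnd ℂ c * c) * (star x ⬝ᵥ M *ᵥ x) := by
  rw [star_smul, mulVec_smul, dotProduct_smul, smul_dotProduct, smul_smul, smul_eq_mul,
    Complex.star_def, mul_comm c]

/-- **A positive definite matrix dominates a small multiple of any Hermitian matrix**: if `Y > 0`
and `Z = Zᴴ` then `Y - ε Z ≥ 0` for some `ε > 0` (compare the quadratic forms on the unit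
sphere: `min ⟨x, Y x⟩ > 0`, `max ⟨x, Z x⟩ < ∞`). [folklore] -/
theorem exists_pos_sub_smul_posSemidef {Y Z : Matrix n n ℂ} (hY : Y.PosDef)
    (hZ : Z.IsHermitian) : ∃ ε : ℝ, 0 < ε ∧ (Y - (ε : ℂ) • Z).PosSemidef := by
  have hherm : ∀ ε : ℝ, (Y - (ε : ℂ) • Z).IsHermitian := fun ε => hY.1.sub (isHermitian_real_smul hZ ε)
  rcases isEmpty_or_nonempty n with hn | hn
  · refine ⟨1, one_pos, posSemidef_of_re_nonneg (hherm 1) fun x => ?_⟩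
    rw [Subsingleton.elim x 0]
    simp
  -- quadratic forms on the unit sphere of `n → ℂ` (sup norm)
  let K := Metric.sphere (0 : n → ℂ) 1
  have hK : IsCompact K := isCompact_sphere 0 1
  have hKne : K.Nonempty := NormedSpace.sphere_nonempty.mpr zero_le_one
  let f : (n → ℂ) → ℝ := fun x => (star x ⬝ᵥ Y *ᵥ x).re
  let g : (n → ℂ) → ℝ := fun x => (star x ⬝ᵥ Z *ᵥ x).re
  have hcont : ∀ M : Matrix n n ℂ, Continuous fun x : n → ℂ => (star x ⬝ᵥ M *ᵥ x).re := fun M =>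
    Complex.continuous_re.comp
      ((continuous_id.star).dotProduct (continuous_const.matrix_mulVec continuous_id))
  obtain ⟨x₁, hx₁K, hx₁⟩ := hK.exists_isMinOn hKne (hcont Y).continuousOn
  obtain ⟨x₂, hx₂K, hx₂⟩ := hK.exists_isMaxOn hKne (hcont Z).continuousOn
  have hx₁0 : x₁ ≠ 0 := by
    rintro rfl
    simp [K] at hx₁K
  have hlam : 0 < f x₁ := hY.re_dotProduct_pos hx₁0
  set ε : ℝ := f x₁ / (|g x₂| + 1) with hε
  have hε0 : 0 < ε := by positivity
  refine ⟨ε, hε0, posSemidef_of_re_nonneg (hherm _) fun x => ?_⟩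
  by_cases hx : x = 0
  · simp [hx]
  -- normalise `x = ‖x‖ • u` with `u ∈ K`
  set c : ℝ := ‖x‖ with hc
  have hc0 : 0 < c := norm_pos_iff.mpr hx
  set u : n → ℂ := (c⁻¹ : ℂ) • x with hu
  have huK : u ∈ K := by
    simp [K, u, norm_smul, hc0.ne', c]
  have hxu : x = (c : ℂ) • u := by
    rw [hu, smul_smul, mul_inv_cancel₀ (by exact_mod_cast hc0.ne'), one_smul]
  have hfu : f x₁ ≤ (star u ⬝ᵥ Y *ᵥ u).re := hx₁ huK
  have hgu : (star u ⬝ᵥ Z *ᵥ u).re ≤ |g x₂| := (hx₂ huK).trans (le_abs_self _)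
  have hform : star x ⬝ᵥ (Y - (ε : ℂ) • Z) *ᵥ x =
      ((c : ℂ) ^ 2) * ((star u ⬝ᵥ Y *ᵥ u) - (ε : ℂ) * (star u ⬝ᵥ Z *ᵥ u)) := by
    rw [hxu, star_smul_dotProduct_mulVec_smul, Complex.conj_ofReal, sub_mulVec, dotProduct_sub,
      smul_mulVec, dotProduct_smul, smul_eq_mul, sq]
  rw [hform]
  have hre : (((c : ℂ) ^ 2) * ((star u ⬝ᵥ Y *ᵥ u) - (ε : ℂ) * (star u ⬝ᵥ Z *ᵥ u))).re =
      c ^ 2 * ((star u ⬝ᵥ Y *ᵥ u).re - ε * (star u ⬝ᵥ Z *ᵥ u).re) := by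
    simp [Complex.mul_re, Complex.sub_re, ← Complex.ofReal_pow]
  rw [hre]
  refine mul_nonneg (sq_nonneg _) (sub_nonneg.mpr ?_)
  calc ε * (star u ⬝ᵥ Z *ᵥ u).re
      ≤ ε * |g x₂| := mul_le_mul_of_nonneg_left hgu hε0.le
    _ ≤ f x₁ := by
        rw [hε, div_mul_eq_mul_div, div_le_iff₀ (by positivity)]
        nlinarith [abs_nonneg (g x₂)]
    _ ≤ (star u ⬝ᵥ Y *ᵥ u).re := hfu

end Cone

/-! ### The Perron–Frobenius eigenvector (Collatz–Wielandt) -/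

/-- Positive semidefinite non-zero matrices have trace of positive real part. [folklore] -/
theorem trace_re_pos_of_posSemidef {n : Type*} [Fintype n] {Z : Matrix n n ℂ} (hZ : Z.PosSemidef)
    (hZ0 : Z ≠ 0) : 0 < Z.trace.re := by
  have h1 : 0 ≤ Z.trace := hZ.trace_nonneg
  have h2 : Z.trace ≠ 0 := fun h => hZ0 (hZ.trace_eq_zero_iff.mp h)
  obtain ⟨hre, him⟩ := Complex.nonneg_iff.mp h1
  refine lt_of_le_of_ne hre fun h0 => h2 (Complex.ext ?_ ?_)
  · simpa using h0.symm
  · simpa using him.symm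

/-- An eigenvector of `𝔼` is an eigenvector of every iterate: `𝔼 X = c X ⇒ 𝔼^k X = c^k X`.
[folklore] -/
theorem transferOp_pow_apply_of_eigen (A : MPSTensor q D) {X : Matrix (Fin D) (Fin D) ℂ} {c : ℂ}
    (hX : transferOp A X = c • X) (k : ℕ) : (transferOp A ^ k) X = c ^ k • X := by
  induction k with
  | zero => simp
  | succ k ih => rw [pow_succ, Module.End.mul_apply, hX, map_smul, ih, smul_smul, pow_succ']

/-- **Perron–Frobenius eigenvector of the transfer operator of an injective tensor**
(Collatz–Wielandt form). If the words of a positive length `ℓ` span `M_D(ℂ)` and `D > 0`, there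
are `r₀ > 0` and a positive definite `X₀` with `𝔼(X₀) = r₀ X₀`. Proof in the module docstring:
`r₀ = sup {t | ∃ Z ≥ 0 normalised, t Z ≤ 𝔼 Z}` is attained by compactness, and strict positivity
of `𝔼^ℓ` (`IsInjectiveMPS.posDef_transferOp_pow`) upgrades `r₀ Z⋆ ≤ 𝔼 Z⋆` to equality with
`Z⋆ > 0`, `r₀ > 0`. Evans–Høegh-Krohn (1978) Thm. 2.3–2.4 (Perron–Frobenius for positive maps on
finite-dimensional C⋆-algebras); Perez-Garcia–Verstraete–Wolf–Cirac (2007) §3.2 Thm. 5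
(injectivity ⇒ primitivity); Fannes–Nachtergaele–Werner (1992) §5 (5.1).
[cite: PerezGarciaVerstraeteWolfCiracQIC2007, §3.2 Thm. 5] -/
theorem IsInjectiveMPS.exists_posDef_eigenvector [NeZero D] {A : MPSTensor q D} {ℓ : ℕ}
    (h : IsInjectiveMPS A ℓ) (hℓ : 0 < ℓ) :
    ∃ r₀ : ℝ, 0 < r₀ ∧ ∃ X₀ : Matrix (Fin D) (Fin D) ℂ, X₀.PosDef ∧
      transferOp A X₀ = (r₀ : ℂ) • X₀ := by
  set T := transferOp A with hT
  -- the ratio set of the Collatz–Wielandt argument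
  set S : Set (Matrix (Fin D) (Fin D) ℂ) :=
    (fun G : Matrix (Fin D) (Fin D) ℂ => Gᴴ * G) '' Metric.sphere 0 1 with hS
  set R : Set ℝ := {t | ∃ Z ∈ S, (T Z - (t : ℂ) • Z).PosSemidef} with hR
  have hScpt := isCompact_normPSD D
  -- `S` is non-empty (normalise the identity), so `0 ∈ R`
  obtain ⟨c₁, -, Z₁, hZ₁S, -⟩ :=
    exists_smul_mem_normPSD (D := D) PosSemidef.one one_ne_zero
  have hSne : S.Nonempty := ⟨Z₁, hZ₁S⟩
  have hR0 : (0 : ℝ) ∈ R :=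
    ⟨Z₁, hZ₁S, by
      rw [Complex.ofReal_zero, zero_smul, sub_zero]
      exact transferOp_posSemidef A (posSemidef_of_mem_normPSD hZ₁S)⟩
  -- `R` is bounded above: compare traces, uniformly on the compact set `S`
  have hcont_tr : Continuous fun Z : Matrix (Fin D) (Fin D) ℂ => (Z.trace).re :=
    Complex.continuous_re.comp continuous_id.matrix_trace
  have hcont_trT : Continuous fun Z : Matrix (Fin D) (Fin D) ℂ => ((T Z).trace).re :=
    Complex.continuous_re.comp (T.continuous_of_finiteDimensional).matrix_trace
  obtain ⟨Zm, hZmS, hZm⟩ := hScpt.exists_isMinOn hSne hcont_tr.continuousOn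
  obtain ⟨ZM, hZMS, hZM⟩ := hScpt.exists_isMaxOn hSne hcont_trT.continuousOn
  have hm : 0 < (Zm.trace).re :=
    trace_re_pos_of_posSemidef (posSemidef_of_mem_normPSD hZmS) (ne_zero_of_mem_normPSD hZmS)
  have hM : 0 ≤ ((T ZM).trace).re :=
    (Complex.nonneg_iff.mp
      (transferOp_posSemidef A (posSemidef_of_mem_normPSD hZMS)).trace_nonneg).1
  have hRbdd : BddAbove R := by
    refine ⟨((T ZM).trace).re / (Zm.trace).re, ?_⟩
    rintro t ⟨Z, hZS, hZt⟩
    have h1 : t * (Z.trace).re ≤ ((T Z).trace).re := by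
      have := (Complex.nonneg_iff.mp hZt.trace_nonneg).1
      rw [trace_sub, trace_smul, Complex.sub_re, smul_eq_mul, Complex.re_ofReal_mul] at this
      linarith
    have h2 : (Zm.trace).re ≤ (Z.trace).re := hZm hZS
    have h3 : ((T Z).trace).re ≤ ((T ZM).trace).re := hZM hZS
    rw [le_div_iff₀ hm]
    rcases le_or_gt 0 t with ht | ht
    · calc t * (Zm.trace).re ≤ t * (Z.trace).re := mul_le_mul_of_nonneg_left h2 ht
        _ ≤ ((T ZM).trace).re := h1.trans h3
    · exact (mul_nonpos_of_nonpos_of_nonneg ht.le hm.le).trans hM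
  -- `r₀ = sup R` is attained: approximating sequence, compactness, closedness of the cone
  set r₀ := sSup R with hr₀
  obtain ⟨u, -, hu, huR⟩ := exists_seq_tendsto_sSup ⟨0, hR0⟩ hRbdd
  choose Z hZS hZpsd using huR
  obtain ⟨Zs, hZsS, φ, hφ, hlim⟩ := hScpt.tendsto_subseq hZS
  have hlimT : Tendsto (fun k => T (Z (φ k)) - ((u (φ k) : ℝ) : ℂ) • Z (φ k)) atTop
      (𝓝 (T Zs - (r₀ : ℂ) • Zs)) := by
    have h1 : Tendsto (fun k => T (Z (φ k))) atTop (𝓝 (T Zs)) :=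
      (T.continuous_of_finiteDimensional.tendsto _).comp hlim
    have h2 : Tendsto (fun k => ((u (φ k) : ℝ) : ℂ)) atTop (𝓝 (r₀ : ℂ)) :=
      (Complex.continuous_ofReal.tendsto _).comp (hu.comp hφ.tendsto_atTop)
    exact h1.sub (h2.smul hlim)
  have hZs_ge : (T Zs - (r₀ : ℂ) • Zs).PosSemidef :=
    posSemidef_of_tendsto hlimT fun k => hZpsd (φ k)
  have hZs_psd : Zs.PosSemidef := posSemidef_of_mem_normPSD hZsS
  have hZs0 : Zs ≠ 0 := ne_zero_of_mem_normPSD hZsS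
  -- equality `T Zs = r₀ Zs`: otherwise strict positivity of `T^ℓ` pushes the ratio above `r₀`
  have heq : T Zs - (r₀ : ℂ) • Zs = 0 := by
    by_contra hW
    have hZ1pd : ((T ^ ℓ) Zs).PosDef := h.posDef_transferOp_pow hZs_psd hZs0
    have hTW : (T ^ ℓ) (T Zs - (r₀ : ℂ) • Zs) = T ((T ^ ℓ) Zs) - (r₀ : ℂ) • (T ^ ℓ) Zs := by
      rw [map_sub, map_smul, transferOp_pow_comm_apply]
    have hpd : (T ((T ^ ℓ) Zs) - (r₀ : ℂ) • (T ^ ℓ) Zs).PosDef :=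
      hTW ▸ h.posDef_transferOp_pow hZs_ge hW
    obtain ⟨ε, hε, hεpsd⟩ := exists_pos_sub_smul_posSemidef hpd hZ1pd.1
    have hZ10 : (T ^ ℓ) Zs ≠ 0 := by
      intro h0
      have := hZ1pd.trace_pos
      rw [h0, trace_zero] at this
      exact lt_irrefl _ this
    obtain ⟨c, hc, Z', hZ'S, hZ1eq⟩ := exists_smul_mem_normPSD hZ1pd.posSemidef hZ10
    have hmem : r₀ + ε ∈ R := by
      refine ⟨Z', hZ'S, ?_⟩
      -- `T Z₁ - r₀ Z₁ - ε Z₁ = c • (T Z' - (r₀ + ε) Z')` with `c > 0`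
      have hrel : T ((T ^ ℓ) Zs) - (r₀ : ℂ) • (T ^ ℓ) Zs - (ε : ℂ) • (T ^ ℓ) Zs =
          (c : ℂ) • (T Z' - ((r₀ + ε : ℝ) : ℂ) • Z') := by
        rw [hZ1eq, map_smul]
        push_cast
        module
      have hpsd' : ((c : ℂ)⁻¹ • ((c : ℂ) • (T Z' - ((r₀ + ε : ℝ) : ℂ) • Z'))).PosSemidef := by
        rw [← hrel]
        exact hεpsd.smul (by
          rw [← Complex.ofReal_inv]
          exact Complex.zero_le_real.mpr (inv_nonneg.mpr hc.le))
      rwa [smul_smul, inv_mul_cancel₀ (by exact_mod_cast hc.ne'), one_smul] at hpsd'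
    have := le_csSup hRbdd hmem
    linarith
  have hTZs : T Zs = (r₀ : ℂ) • Zs := sub_eq_zero.mp heq
  -- `r₀ > 0` and `Zs > 0` from `r₀^ℓ Zs = T^ℓ Zs > 0`
  have hpow : (T ^ ℓ) Zs = ((r₀ : ℂ) ^ ℓ) • Zs := transferOp_pow_apply_of_eigen A hTZs ℓ
  have hpd : (((r₀ : ℂ) ^ ℓ) • Zs).PosDef := hpow ▸ h.posDef_transferOp_pow hZs_psd hZs0
  have hr₀0 : 0 ≤ r₀ := le_csSup hRbdd hR0
  have hr₀ℓ : (r₀ : ℂ) ^ ℓ ≠ 0 := by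
    intro h0
    have := hpd.trace_pos
    rw [h0, zero_smul, trace_zero] at this
    exact lt_irrefl _ this
  have hr₀pos : 0 < r₀ := by
    refine lt_of_le_of_ne hr₀0 fun h0 => hr₀ℓ ?_
    rw [← h0, Complex.ofReal_zero, zero_pow hℓ.ne']
  refine ⟨r₀, hr₀pos, Zs, ?_, hTZs⟩
  -- `Zs = (r₀^ℓ)⁻¹ • (r₀^ℓ • Zs)` is positive definite
  have hinv : 0 < ((r₀ ^ ℓ)⁻¹ : ℝ) := inv_pos.mpr (pow_pos hr₀pos ℓ)
  have := hpd.smul (Complex.zero_lt_real.mpr hinv)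
  rwa [← Complex.ofReal_pow, smul_smul, ← Complex.ofReal_mul,
    inv_mul_cancel₀ (pow_ne_zero ℓ hr₀pos.ne'), Complex.ofReal_one, one_smul] at this

end QLattice

end Literature.MathematicalPhysics.QuantumLattice
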